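import Summits.FinalStateConjecture.FinalStateConjecture.Statement

/-!
# Solo (blind) — future sets in a timelike-fibred product are strict supergraphs

The ENVELOPE VARIANT of the bag-of-gold analysis (`paper/bag-of-gold-note.md`, Note B, §B13)
replaces the capped late leaves of a putative final-state decomposition by the boundary of the
chronological future `I⁺(W)` of the charted set `W`, read in a product chart `ℝ × Ỹ` of the late
bag region whose fibres `ℝ × {y}` are future-directed timelike.  The point of the variant is that
such a boundary is AUTOMATICALLY an entire continuous graph over `Ỹ` — no graph, properness or
capping hypothesis is needed — so that the order-theoretic core (`SoloBlindOrder`) applies to it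
directly.  This file proves that statement in the abstract:

* `soloBlind_exists_boundaryFunction` — let `A ⊆ ℝ × Y` be OPEN and a FUTURE SET for a relation
  `≪` (`p ≪ q`, `p ∈ A` ⇒ `q ∈ A`) such that `(σ, y') ≪ (σ', y)` for `σ < σ'` and all `y'` near
  `y` (fibres timelike, chronological pasts of points open); if every fibre meets `A` and no fibre
  lies in `A`, then `A = {(σ, y) | f y < σ}` for a (unique) CONTINUOUS `f : Y → ℝ`
  (`f y = inf {σ | (σ, y) ∈ A}`; upper semicontinuity from openness of `A`, lower semicontinuity
  from the cone condition).
* `soloBlind_closure_eq_of_boundaryFunction`, `soloBlind_frontier_eq_graph_of_boundaryFunction` —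
  then `closure A = {f y ≤ σ}` and `frontier A` is exactly the graph `{σ = f y}`.

In Note B, `A = I⁺(W̃′) ∩ G̃` for the lifted charted set; its frontier, the ENVELOPE, is thus an
entire graph over the universal cover `Ỹ`, equivariant under the deck group by construction, and
§B13 reduces the contradiction of Case B to the disjointness of the envelope from its deck
translates (CLAIM D there).  References for the causal-theoretic inputs (used only in Note B, not
here): B. O'Neill, *Semi-Riemannian geometry*, Academic Press 1983, Ch. 14, Lemma 14.3 (`I⁺(S)`
open) and Cor. 14.27 (achronal boundaries `∂I⁺(S)` are closed topological hypersurfaces).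
-/

noncomputable section

open Set Filter
open scoped Topology

set_option linter.dupNamespace false

namespace Summit.FinalStateConjecture.FinalStateConjecture.Theorems

section FutureSet

variable {Y : Type*} [TopologicalSpace Y]

/-- BOUNDARY FUNCTION OF A FUTURE SET.  An open future set `A` in a timelike-fibred product
`ℝ × Y` (cone condition `hcone`) that every fibre meets but no fibre exhausts is the strict
supergraph `{(σ, y) | f y < σ}` of a continuous function `f`. -/
theorem soloBlind_exists_boundaryFunction {ll : ℝ × Y → ℝ × Y → Prop} {A : Set (ℝ × Y)}
    (hA : IsOpen A) (hfut : ∀ p q, ll p q → p ∈ A → q ∈ A)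
    (hcone : ∀ (y : Y) (σ σ' : ℝ), σ < σ' → ∀ᶠ y' in 𝓝 y, ll (σ, y') (σ', y))
    (hmeet : ∀ y, ∃ σ : ℝ, (σ, y) ∈ A) (hmiss : ∀ y, ∃ σ : ℝ, (σ, y) ∉ A) :
    ∃ f : Y → ℝ, Continuous f ∧ ∀ (σ : ℝ) (y : Y), (σ, y) ∈ A ↔ f y < σ := by
  -- fibrewise upward closure of `A`
  have hup : ∀ (y : Y) (σ σ' : ℝ), σ < σ' → (σ, y) ∈ A → (σ', y) ∈ A :=
    fun y σ σ' h hσ => hfut _ _ (hcone y σ σ' h).self_of_nhds hσ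
  have hbdd : ∀ y, BddBelow {σ : ℝ | (σ, y) ∈ A} := by
    intro y
    obtain ⟨σ₀, hσ₀⟩ := hmiss y
    refine ⟨σ₀, fun σ hσ => ?_⟩
    by_contra hlt
    exact hσ₀ (hup y σ σ₀ (lt_of_not_ge hlt) hσ)
  have hne : ∀ y, ({σ : ℝ | (σ, y) ∈ A}).Nonempty := fun y => hmeet y
  refine ⟨fun y => sInf {σ : ℝ | (σ, y) ∈ A}, ?_, ?_⟩
  swap
  -- the characterisation `(σ, y) ∈ A ↔ f y < σ`, proved first (as a `have` below it is reused)
  · intro σ y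
    constructor
    · intro hσ
      have hc : Continuous fun t : ℝ => (t, y) := by fun_prop
      have hN : (fun t : ℝ => (t, y)) ⁻¹' A ∈ 𝓝 σ :=
        hc.continuousAt.preimage_mem_nhds (hA.mem_nhds hσ)
      obtain ⟨l, hl, hsub⟩ := exists_Ioc_subset_of_mem_nhds hN ⟨σ - 1, by linarith⟩
      obtain ⟨t, hlt, htσ⟩ := exists_between hl
      have ht : (t, y) ∈ A := hsub ⟨hlt, htσ.le⟩
      exact lt_of_le_of_lt (csInf_le (hbdd y) ht) htσ
    · intro hlt
      obtain ⟨σ', hσ', hσ'σ⟩ := exists_lt_of_csInf_lt (hne y) hlt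
      exact hup y σ' σ hσ'σ hσ'
  · -- continuity: upper semicontinuity from openness, lower semicontinuity from the cones
    have key : ∀ (σ : ℝ) (y : Y), (σ, y) ∈ A ↔ sInf {σ : ℝ | (σ, y) ∈ A} < σ := by
      intro σ y
      constructor
      · intro hσ
        have hc : Continuous fun t : ℝ => (t, y) := by fun_prop
        have hN : (fun t : ℝ => (t, y)) ⁻¹' A ∈ 𝓝 σ :=
          hc.continuousAt.preimage_mem_nhds (hA.mem_nhds hσ)
        obtain ⟨l, hl, hsub⟩ := exists_Ioc_subset_of_mem_nhds hN ⟨σ - 1, by linarith⟩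
        obtain ⟨t, hlt, htσ⟩ := exists_between hl
        have ht : (t, y) ∈ A := hsub ⟨hlt, htσ.le⟩
        exact lt_of_le_of_lt (csInf_le (hbdd y) ht) htσ
      · intro hlt
        obtain ⟨σ', hσ', hσ'σ⟩ := exists_lt_of_csInf_lt (hne y) hlt
        exact hup y σ' σ hσ'σ hσ'
    rw [continuous_iff_lower_upperSemicontinuous, lowerSemicontinuous_iff,
      upperSemicontinuous_iff]
    refine ⟨fun y => ?_, fun y => ?_⟩
    · rw [lowerSemicontinuousAt_iff]
      intro c hc
      obtain ⟨c'', hcc'', hc''⟩ := exists_between hc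
      obtain ⟨c', hcc', hc'c''⟩ := exists_between hcc''
      have hnot : (c'', y) ∉ A := fun h => absurd ((key _ _).mp h) (not_lt.mpr hc''.le)
      filter_upwards [hcone y c' c'' hc'c''] with y' hy'
      have hnot' : (c', y') ∉ A := fun h => hnot (hfut _ _ hy' h)
      have hle : c' ≤ sInf {σ : ℝ | (σ, y') ∈ A} :=
        not_lt.mp fun h => hnot' ((key _ _).mpr h)
      exact lt_of_lt_of_le hcc' hle
    · rw [upperSemicontinuousAt_iff]
      intro c hc
      have hmem : (c, y) ∈ A := (key _ _).mpr hc
      have hc2 : Continuous fun y' : Y => (c, y') := by fun_prop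
      filter_upwards [hc2.continuousAt.preimage_mem_nhds (hA.mem_nhds hmem)] with y' hy'
      exact (key _ _).mp hy'

omit [TopologicalSpace Y] in
/-- UNIQUENESS of the boundary function. -/
theorem soloBlind_boundaryFunction_unique {A : Set (ℝ × Y)} {f f' : Y → ℝ}
    (hf : ∀ (σ : ℝ) (y : Y), (σ, y) ∈ A ↔ f y < σ)
    (hf' : ∀ (σ : ℝ) (y : Y), (σ, y) ∈ A ↔ f' y < σ) : f = f' := by
  funext y
  by_contra hne
  rcases lt_or_gt_of_ne hne with h | h
  · obtain ⟨σ, h1, h2⟩ := exists_between h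
    exact absurd ((hf' σ y).mp ((hf σ y).mpr h1)) (not_lt.mpr h2.le)
  · obtain ⟨σ, h1, h2⟩ := exists_between h
    exact absurd ((hf σ y).mp ((hf' σ y).mpr h1)) (not_lt.mpr h2.le)

/-- CLOSURE of a strict supergraph of a continuous function is the weak supergraph. -/
theorem soloBlind_closure_eq_of_boundaryFunction {A : Set (ℝ × Y)} {f : Y → ℝ}
    (hfc : Continuous f) (hf : ∀ (σ : ℝ) (y : Y), (σ, y) ∈ A ↔ f y < σ) :
    closure A = {p : ℝ × Y | f p.2 ≤ p.1} := by
  apply Subset.antisymm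
  · refine closure_minimal (fun p hp => ?_) (isClosed_le (hfc.comp continuous_snd) continuous_fst)
    have h := (hf p.1 p.2).mp (by simpa using hp)
    exact h.le
  · rintro ⟨σ, y⟩ (hle : f y ≤ σ)
    have hc : Continuous fun t : ℝ => (t, y) := by fun_prop
    have hsub : (fun t : ℝ => (t, y)) '' Ioi σ ⊆ A := by
      rintro _ ⟨t, ht, rfl⟩
      exact (hf t y).mpr (lt_of_le_of_lt hle ht)
    have hmem : ((σ, y) : ℝ × Y) ∈ (fun t : ℝ => (t, y)) '' closure (Ioi σ) :=
      ⟨σ, by rw [closure_Ioi]; exact self_mem_Ici, rfl⟩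
    exact closure_mono hsub (image_closure_subset_closure_image hc hmem)

/-- The FRONTIER of an open strict supergraph of a continuous function is the graph: in Note B,
the envelope `∂I⁺(W̃′)` is the entire graph `σ = f(y)` over `Ỹ`. -/
theorem soloBlind_frontier_eq_graph_of_boundaryFunction {A : Set (ℝ × Y)} {f : Y → ℝ}
    (hA : IsOpen A) (hfc : Continuous f) (hf : ∀ (σ : ℝ) (y : Y), (σ, y) ∈ A ↔ f y < σ) :
    frontier A = {p : ℝ × Y | f p.2 = p.1} := by
  rw [hA.frontier_eq, soloBlind_closure_eq_of_boundaryFunction hfc hf]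
  ext ⟨σ, y⟩
  rw [Set.mem_sdiff, hf σ y]
  simp only [mem_setOf_eq, not_lt]
  exact ⟨fun h => le_antisymm h.1 h.2, fun h => ⟨h.le, h.ge⟩⟩

/-- The frontier is the range of the graph map `y ↦ (f y, y)` — the form consumed by
`soloBlind_disjoint_graph_translate_iff` in `SoloBlindOrder`. -/
theorem soloBlind_frontier_eq_range_of_boundaryFunction {A : Set (ℝ × Y)} {f : Y → ℝ}
    (hA : IsOpen A) (hfc : Continuous f) (hf : ∀ (σ : ℝ) (y : Y), (σ, y) ∈ A ↔ f y < σ) :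
    frontier A = range fun y : Y => (f y, y) := by
  rw [soloBlind_frontier_eq_graph_of_boundaryFunction hA hfc hf]
  ext ⟨σ, y⟩
  constructor
  · intro (h : f y = σ)
    exact ⟨y, show ((f y, y) : ℝ × Y) = (σ, y) by rw [h]⟩
  · rintro ⟨y', hy'⟩
    simp only [Prod.mk.injEq] at hy'
    obtain ⟨h1, rfl⟩ := hy'
    exact h1

end FutureSet

section Equivariance

variable {Γ : Type*} [Group Γ] {Y : Type*} [MulAction Γ Y]

/-- COVARIANCE.  The deck translate `{(σ, g • y) | (σ, y) ∈ A}` of the strict supergraph of `f`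
is the strict supergraph of `y ↦ f (g⁻¹ • y)`; in Note B: the envelope of the future of the lift
`g • W̃′` is the `g`-translate of the envelope of the future of `W̃′`. -/
theorem soloBlind_mem_translate_iff_of_boundaryFunction {A : Set (ℝ × Y)} {f : Y → ℝ}
    (hf : ∀ (σ : ℝ) (y : Y), (σ, y) ∈ A ↔ f y < σ) (g : Γ) (σ : ℝ) (y : Y) :
    (σ, y) ∈ (fun p : ℝ × Y => (p.1, g • p.2)) '' A ↔ f (g⁻¹ • y) < σ := by
  constructor
  · rintro ⟨⟨σ', y'⟩, hp, hpe⟩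
    simp only [Prod.mk.injEq] at hpe
    obtain ⟨rfl, rfl⟩ := hpe
    rw [inv_smul_smul]
    exact (hf σ' y').mp hp
  · intro h
    exact ⟨(σ, g⁻¹ • y), (hf σ _).mpr h, by simp [smul_inv_smul]⟩

/-- DISJOINT ENVELOPES.  The graphs of `f` and of `y ↦ f (g⁻¹ • y)` — the frontiers of `A` and of
its `g`-translate, by `soloBlind_frontier_eq_graph_of_boundaryFunction` — are disjoint iff
`f y ≠ f (g⁻¹ • y)` for all `y`.  Pairwise disjointness of the envelope from its non-trivial
translates (CLAIM D of Note B §B13) is therefore exactly the hypothesis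
`∀ g ≠ 1, ∀ y, f y ≠ f (g • y)` of the order-theoretic core (`SoloBlindOrder`). -/
theorem soloBlind_disjoint_graphs_iff (f : Y → ℝ) (g : Γ) :
    Disjoint {p : ℝ × Y | f p.2 = p.1} {p : ℝ × Y | f (g⁻¹ • p.2) = p.1} ↔
      ∀ y, f y ≠ f (g⁻¹ • y) := by
  constructor
  · intro h y hy
    exact Set.disjoint_left.mp h (show ((f y, y) : ℝ × Y) ∈ {p : ℝ × Y | f p.2 = p.1} from rfl)
      (show f (g⁻¹ • y) = f y from hy.symm)
  · intro h
    refine Set.disjoint_left.mpr ?_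
    rintro ⟨σ, y⟩ (h1 : f y = σ) (h2 : f (g⁻¹ • y) = σ)
    exact h y (h1.trans h2.symm)

/-- Reindexing `g ↦ g⁻¹`: disjointness from ALL non-trivial translates in either convention. -/
theorem soloBlind_forall_ne_inv_smul_iff (f : Y → ℝ) :
    (∀ g : Γ, g ≠ 1 → ∀ y, f y ≠ f (g⁻¹ • y)) ↔ ∀ g : Γ, g ≠ 1 → ∀ y, f y ≠ f (g • y) := by
  constructor
  · intro h g hg y
    simpa only [inv_inv] using h g⁻¹ (inv_ne_one.mpr hg) y
  · intro h g hg y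
    exact h g⁻¹ (inv_ne_one.mpr hg) y

/-- WARNING (why a single lift).  If the future set is INVARIANT under the deck action — as is the
chronological future of the full preimage of a set downstairs — its boundary function is
`Γ`-invariant, its graph coincides with all its translates, and the order argument is void.  This
is why Note B §B13 takes the future of ONE lift `W̃′` of the (simply connected) chart image. -/
theorem soloBlind_boundaryFunction_invariant {A : Set (ℝ × Y)} {f : Y → ℝ}
    (hf : ∀ (σ : ℝ) (y : Y), (σ, y) ∈ A ↔ f y < σ)
    (hinv : ∀ (g : Γ) (σ : ℝ) (y : Y), (σ, y) ∈ A ↔ (σ, g • y) ∈ A) (g : Γ) (y : Y) :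
    f (g • y) = f y := by
  by_contra hne
  rcases lt_or_gt_of_ne hne with h | h
  · obtain ⟨σ, h1, h2⟩ := exists_between h
    have hmem : (σ, y) ∈ A := (hinv g σ y).mpr ((hf σ (g • y)).mpr h1)
    exact absurd ((hf σ y).mp hmem) (not_lt.mpr h2.le)
  · obtain ⟨σ, h1, h2⟩ := exists_between h
    have hmem : (σ, g • y) ∈ A := (hinv g σ y).mp ((hf σ y).mpr h1)
    exact absurd ((hf σ (g • y)).mp hmem) (not_lt.mpr h2.le)

end Equivariance

end Summit.FinalStateConjecture.FinalStateConjecture.Theorems
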